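import Summits.BirchSwinnertonDyer.BirchSwinnertonDyer.Theorems.KimAtThreeD7uTamagawaIndexCorollaries
import Summits.BirchSwinnertonDyer.BirchSwinnertonDyer.Theorems.KimAtThreeD7uTamagawaFreeTate
import Summits.BirchSwinnertonDyer.Rank1Residual.GaloisImage.TorsionReductionOfLe
import Summits.BirchSwinnertonDyer.Rank1Residual.GaloisImage.PropagatedConditionTopOfNoTorsionAnyPrime
import HarnessLib

/-!
# The Tamagawa index AT THE TATE MODULE, I: a class of `H¹(ℚ_w, T_pE)` is unramified iff ALL its
# reductions `π_{k+1,*} y ∈ H¹(ℚ_w, E[p^{k+1}])` are (`lim¹ = 0` by König's lemma), and the finite-level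
# conditions `𝓕_u(w)_k = π_{k+1,*} H¹_ur`, `𝓕_can(w)_k = π_{k+1,*} H¹` form a SURJECTIVE tower under `red`
# (cell `bsd-addord`, seat w2-tamdiv gen 8; route W2 `KimAtThreeKolyvagin`, items 19562 / 19560, «TamDiv∞»)

HONEST FRAMING: TOOL theorems (no definition, no named fact, no `sorry`); closes nothing by itself;
nothing is booked; BSD is not proved by any of this.  Part XXVII of the seat's series.  The object left
open by w2-acc5 g3's E-free local index package `KimAtThreeDeepUpperOffStratumLocalIndex`
(`0 → H¹_ur(ℚ_w, T) → H¹(ℚ_w, T) → H¹(I_w, T)^{Fr} → 0` for `T = T_pE|_{Γ_{ℚ_w}}`; «the E-SPECIFIC order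
`#H¹(I_w, T_pE)^{Fr} = (c_w)_p` is NOT here») and by this seat's gens 3/4 (part III
`KimAtThreeD7uTamagawaFreeTate`: the case `p ∤ c_w`; part VII `KimAtThreeD7uTamagawaIndex`: the index
`#𝓕_can(w)_k = #𝓕_u(w)_k · #Φ_w[p^{k+1}]` at every FINITE level, «limit `k → ∞` not written») is the
`T_pE`-LEVEL index `[H¹(ℚ_w, T_pE) : H¹_ur(ℚ_w, T_pE)] = (c_w)_p` (Rubin, *Euler Systems*, Lemma 1.3.5 (iii);
Büyükboduk 2009 §2.1.2 Remark 2).  This part supplies the two inputs of the passage to the limit (part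
XXVIII `KimAtThreeD7uTamagawaTateIndex` concludes):

* §1 **`resSubgroup_absInertia_eq_zero_of_forall_tateLocalMap_mem_unramifiedSubgroup`** — for ANY
  prime `p`, ANY finite place `w` (also `w ∣ p`) and `y ∈ H¹(ℚ_w, T_pE)`: if EVERY reduction
  `π_{k+1,*} y ∈ H¹(ℚ_w, E[p^k · p])` is unramified then `res_{I_w} y = 0`.  PROOF = part III §2's
  König / Mittag-Leffler argument with the hypothesis made explicit: a cocycle `η` of `y` is, modulo
  `p^{k+1}`, the coboundary on `I_w` of some `m_k ∈ E[p^k · p]`; the finite non-empty sets of such `m_k`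
  form a tower under `[p]`, and a compatible choice `t = (m_k)_k ∈ T_pE` gives `η|_{I_w} = ∂t`
  (`lim¹_k E[p^k]^{I_w} = 0`).  Hence **`mem_unramifiedSubgroup_tate_iff_forall`**:
  `H¹_ur(ℚ_w, T_pE) = ⋂_k π_{k+1,*}⁻¹ H¹_ur(ℚ_w, E[p^k · p])`.
* §2 (at `w ∤ p`) the finite-level conditions as images — `blochKatoSelmerStructure_inr_eq_map`
  (`𝓕_u(w)_k = π_{k+1,*} H¹_ur(ℚ_w, T_pE)`, [MR04] Rem. A.5 = gen 2's reading, definitional),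
  `propagatedSelmerStructure_inr_eq_range` (`𝓕_can(w)_k = π_{k+1,*} H¹(ℚ_w, T_pE)`), and their
  compatibility with ANY equivariant reduction `red : E[p^{k'} · p] → E[p^k · p]`, `x ↦ p^{k'−k} x`:
  `localMap_red_tateLocalMap_apply` (`red_* ∘ π_{k'+1,*} = π_{k+1,*}`, n1011's `TransportPrime`),
  **`map_localMap_red_propagatedSelmerStructure`** (`red_* 𝓕_can(w)_{k'} = 𝓕_can(w)_k`) and
  **`map_localMap_red_blochKatoSelmerStructure`** (`red_* 𝓕_u(w)_{k'} = 𝓕_u(w)_k`) — EQUALITIES (gen 5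
  part XI had the inclusion `⊆`).
* §3 finiteness / positivity bookkeeping for part XXVIII (`𝓕_u(w)_k` finite and non-empty at `w ∤ p`).

References: K. Rubin, *Euler Systems* (2000) Lemma 1.3.2, Lemma 1.3.5, App. B Prop. B.2.3;
K. Büyükboduk, JNT 129 (2009) §2.1.2 Remark 2; B. Mazur, K. Rubin, Mem. AMS 799 (2004) App. A
Remark A.5, Prop. 6.2.6; J. Neukirch, A. Schmidt, K. Wingberg (2008) (2.7.5); J. S. Milne, *ADT* I §2,
Prop. 3.8, Remark 3.10.
-/

noncomputable section

-- the cell's Theorems namespace `Summit.BirchSwinnertonDyer.BirchSwinnertonDyer.…` repeats the summit name by design (D-0017)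
set_option linter.dupNamespace false

open CategoryTheory Function Field IsDedekindDomain NumberField
open scoped NumberField Classical ContRepresentation
open Literature.NumberTheory.GaloisRepresentations Literature.NumberTheory.EllipticCurves
open Literature.NumberTheory.GaloisRepresentations.IsNonarchimedeanLocalField
open Literature.NumberTheory.GaloisCohomology
open WeierstrassCurve
open Summit.BirchSwinnertonDyer.Rank1Residual.GaloisImage
open Summit.BirchSwinnertonDyer.Rank1Residual.X11b
open Summit.BirchSwinnertonDyer.BirchSwinnertonDyer.Theorems.KimAtThreeDeepUpperOffStratumLocalIndex
open Summit.BirchSwinnertonDyer.BirchSwinnertonDyer.Theorems.KimAtThreeD7uBlochKatoCondition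
open Summit.BirchSwinnertonDyer.BirchSwinnertonDyer.Theorems.KimAtThreeD7uTamagawaFreeTate

namespace Summit.BirchSwinnertonDyer.BirchSwinnertonDyer.Theorems.KimAtThreeD7uTamagawaTateUnramified

variable (W : WeierstrassCurve ℚ) [W.IsElliptic] (p : ℕ) [hp : Fact p.Prime]
  (w : HeightOneSpectrum (𝓞 ℚ))

/-- Local notation: `T_pE|_{Γ_{ℚ_w}}` (= `tateLocalRep W p (Sum.inr w)`, by `rfl`). -/
local notation3 "𝕋" => (GaloisRep.restrictField (HeightOneSpectrum.adicCompletion ℚ w)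
  (WeierstrassCurve.tateGaloisRep W p (W.continuous_galoisRepTate_holds p)).toIntRep)
/-- Local notation: `E[p^k · p]|_{Γ_{ℚ_w}}` (= `(W.torsionGaloisModule (p^k · p)).toLocal (Sum.inr w)`). -/
local notation3 "𝕄[" k "]" => (GaloisRep.restrictField (HeightOneSpectrum.adicCompletion ℚ w)
  (WeierstrassCurve.torsionGaloisModule W ((p : ℤ) ^ k * (p : ℤ))))

/-! ### §1 `H¹_ur(ℚ_w, T_pE) = ⋂_k π_{k+1,*}⁻¹ H¹_ur(ℚ_w, E[p^k · p])` (`lim¹ = 0`, König) -/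

/-- **A `T_pE`-class all of whose reductions are unramified is unramified** (`lim¹_k E[p^k]^{I_w} = 0`).
For `W/ℚ` elliptic, ANY prime `p`, ANY finite place `w` of `ℚ` and `y ∈ H¹(ℚ_w, T_pE)`: if for every `k`
the reduction `π_{k+1,*} y ∈ H¹(ℚ_w, E[p^k · p])` lies in `H¹_ur(ℚ_w, E[p^k · p])`, then `res_{I_w} y = 0`.
König's lemma (part III §1) on the tower of the finite non-empty sets
`S_{k+1} = {m ∈ E[p^k · p] | π_{k+1} ∘ η|_{I_w} = ∂m}` (`η` a cocycle of `y`), mapped into each other by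
`[p]`, gives a compatible `t = (m_k) ∈ T_pE` with `η|_{I_w} = ∂t`.
[cite: Rubin2000, Lemma 1.3.5 and App. B Prop. B.2.3] [cite: NeukirchSchmidtWingberg2008, II §7 (2.7.5)] -/
theorem resSubgroup_absInertia_eq_zero_of_forall_tateLocalMap_mem_unramifiedSubgroup
    (y : (tateLocalRep W p (Sum.inr w)).cohomology 1)
    (hy : ∀ k : ℕ, tateLocalMap W p k (Sum.inr w) y ∈
      DiscreteGaloisModule.unramifiedSubgroup (𝕄[k]) 1) :
    resSubgroup (tateLocalRep W p (Sum.inr w)).toTopRep (absInertia (w.adicCompletion ℚ)) 1 y = 0 := by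
  set F := w.adicCompletion ℚ with hFdef
  set θ : absoluteGaloisGroup F →ₜ* absoluteGaloisGroup ℚ := absGaloisRestrict ℚ F with hθdef
  obtain ⟨η, rfl⟩ := oneCocycleClass_surjective _ y
  -- level `k+1`: `π_{k+1} ∘ η` is the coboundary of some `m ∈ E[p^k · p]` on `I_w`
  have hlevel : ∀ k : ℕ, ∃ m : geomPoints W, m ∈ geomTorsion W ((p : ℤ) ^ k * (p : ℤ)) ∧
      ∀ τ ∈ absInertia F, TateModule.proj p (k + 1) (η.1 τ) = θ τ • m - m := by
    intro k
    have hk : oneCocycleClass _ (pushCocycle W p k (Sum.inr w) η) ∈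
        DiscreteGaloisModule.unramifiedSubgroup (𝕄[k]) 1 := by
      have h := hy k
      rwa [tateLocalMap_oneCocycleClass] at h
    obtain ⟨m, hm⟩ := (LocBridge.mem_unramifiedSubgroup_one_iff_exists (𝕄[k])
      (pushCocycle W p k (Sum.inr w) η)).mp hk
    refine ⟨(m : geomPoints W), m.2, fun τ hτ => ?_⟩
    have h := congrArg (fun z : geomTorsion W ((p : ℤ) ^ k * (p : ℤ)) => (z : geomPoints W)) (hm τ hτ)
    rw [AddSubgroupClass.coe_sub] at h
    exact (show TateModule.proj p (k + 1) (η.1 τ) =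
      ((pushCocycle W p k (Sum.inr w) η).1 τ : geomPoints W) from rfl).trans h
  -- the tower of admissible reductions: `S 0 = {0}`, `S (k+1) = {m ∈ E[p^k·p] | π_{k+1}∘η|_I = ∂m}`
  let S : ℕ → Set (geomPoints W) := fun n => Nat.casesOn n {0} fun k =>
    {m | m ∈ geomTorsion W ((p : ℤ) ^ k * (p : ℤ)) ∧
      ∀ τ ∈ absInertia F, TateModule.proj p (k + 1) (η.1 τ) = θ τ • m - m}
  have hS0 : S 0 = {0} := rfl
  have hSsucc : ∀ k, S (k + 1) = {m | m ∈ geomTorsion W ((p : ℤ) ^ k * (p : ℤ)) ∧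
      ∀ τ ∈ absInertia F, TateModule.proj p (k + 1) (η.1 τ) = θ τ • m - m} := fun k => rfl
  have hfin : ∀ n, (S n).Finite := by
    intro n
    cases n with
    | zero => rw [hS0]; exact Set.finite_singleton 0
    | succ k =>
      rw [hSsucc]
      have hne : ((p ^ (k + 1) : ℕ) : ℤ) ≠ 0 := by exact_mod_cast pow_ne_zero (k + 1) hp.out.ne_zero
      haveI : Finite (geomTorsion W ((p ^ (k + 1) : ℕ) : ℤ)) :=
        finite_torsionPoints_holds W (AlgebraicClosure ℚ) hne
      have hfinT : ((geomTorsion W ((p ^ (k + 1) : ℕ) : ℤ) : AddSubgroup (geomPoints W)) :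
          Set (geomPoints W)).Finite := Set.toFinite _
      refine hfinT.subset fun m hm => ?_
      exact (mem_geomTorsion_pow_mul_iff W p k m).mp hm.1
  have hne : ∀ n, (S n).Nonempty := by
    intro n
    cases n with
    | zero => exact ⟨0, by rw [hS0]; exact Set.mem_singleton 0⟩
    | succ k =>
      obtain ⟨m, hm, hmI⟩ := hlevel k
      exact ⟨m, by rw [hSsucc]; exact ⟨hm, hmI⟩⟩
  have hmap : ∀ n, ∀ a ∈ S (n + 1), (p : ℤ) • a ∈ S n := by
    intro n a ha
    rw [hSsucc] at ha
    obtain ⟨haT, haI⟩ := ha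
    cases n with
    | zero =>
      rw [hS0, Set.mem_singleton_iff]
      rw [mem_geomTorsion_iff, pow_zero, one_mul] at haT
      exact haT
    | succ k =>
      rw [hSsucc]
      refine ⟨zsmul_mem_geomTorsion_level W p k haT, fun τ hτ => ?_⟩
      rw [← TateModule.smul_proj_succ, haI τ hτ, smul_sub, natCast_zsmul, smul_comm]
  obtain ⟨a, haS, ha⟩ := exists_seq_of_finite_tower (fun m : geomPoints W => (p : ℤ) • m) hfin hne hmap
  -- the Tate vector `t = (a n)_n`
  have ha0 : a 0 = 0 := by have h := haS 0; rwa [hS0, Set.mem_singleton_iff] at h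
  have hator : ∀ n, p ^ n • a n = 0 := by
    intro n
    cases n with
    | zero => rw [ha0, smul_zero]
    | succ k =>
      have h := haS (k + 1)
      rw [hSsucc] at h
      have h' := (mem_geomTorsion_pow_mul_iff W p k (a (k + 1))).mp h.1
      rw [mem_geomTorsion_iff, natCast_zsmul] at h'
      exact h'
  have hacompat : ∀ n, p • a (n + 1) = a n := fun n => by rw [← natCast_zsmul]; exact ha n
  let t : W.tateModule p := TateModule.mk a hator hacompat
  -- `η|_{I_w} = ∂t`
  have hprin : ∀ τ ∈ absInertia F, η.1 τ = (tateLocalRep W p (Sum.inr w)).toTopRep.ρ τ t - t := by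
    intro τ hτ
    change η.1 τ = θ τ • t - t
    refine TateModule.ext fun n => ?_
    rw [map_sub, TateModule.proj_smul_of_distribMulAction, TateModule.proj_mk]
    cases n with
    | zero =>
      rw [ha0, smul_zero, sub_zero]
      have h := TateModule.pow_smul_proj 0 (η.1 τ)
      rwa [pow_zero, one_smul] at h
    | succ k =>
      have h := haS (k + 1)
      rw [hSsucc] at h
      exact h.2 τ hτ
  rw [resSubgroup_oneCocycleClass, oneCocycleClass_eq_zero_iff]
  exact ⟨t, fun n => by rw [resSubgroup_pullback_apply, subgroupRep_ρ_apply]; exact hprin _ n.2⟩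

/-- Reductions of unramified `T_pE`-classes are unramified: `π_{k+1,*} H¹_ur(ℚ_w, T_pE) ⊆ H¹_ur(ℚ_w, E[p^k · p])`
(the tree's `BlochKatoDatum.finiteSubgroup_le_unramifiedSubgroup` for the datum `π_{k+1}` at `w`).
[cite: BlochKato1990, (3.7.1)] -/
theorem tateLocalMap_mem_unramifiedSubgroup_of_mem (k : ℕ) {y : (𝕋).cohomology 1}
    (hy : y ∈ GaloisRep.unramifiedSubgroup (𝕋) 1) :
    tateLocalMap W p k (Sum.inr w) y ∈ DiscreteGaloisModule.unramifiedSubgroup (𝕄[k]) 1 := by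
  have hfin : tateLocalMap W p k (Sum.inr w) y ∈ ((tateTorsionDatum W p k).toLocal w).finiteSubgroup :=
    (BlochKatoDatum.mem_finiteSubgroup_iff ((tateTorsionDatum W p k).toLocal w) _).mpr ⟨y, hy, rfl⟩
  exact BlochKatoDatum.finiteSubgroup_le_unramifiedSubgroup ((tateTorsionDatum W p k).toLocal w) hfin

/-- **`H¹_ur(ℚ_w, T_pE) = ⋂_k π_{k+1,*}⁻¹ H¹_ur(ℚ_w, E[p^k · p])`**: a class of `H¹(ℚ_w, T_pE)` is
unramified (the tree's `GaloisRep.unramifiedSubgroup`, i.e. `res_{I_w} y = 0`) iff EVERY finite-level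
reduction `π_{k+1,*} y` is unramified — any prime `p`, any finite place `w`.  (`→` is functoriality; `←`
is §1's `lim¹ = 0`.) [cite: Rubin2000, Lemma 1.3.5 and App. B Prop. B.2.3]
[cite: NeukirchSchmidtWingberg2008, II §7 (2.7.5)] -/
theorem mem_unramifiedSubgroup_tate_iff_forall (y : (𝕋).cohomology 1) :
    y ∈ GaloisRep.unramifiedSubgroup (𝕋) 1 ↔
      ∀ k : ℕ, tateLocalMap W p k (Sum.inr w) y ∈ DiscreteGaloisModule.unramifiedSubgroup (𝕄[k]) 1 := by
  constructor
  · exact fun hy k => tateLocalMap_mem_unramifiedSubgroup_of_mem W p w k hy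
  · intro hy
    exact (mem_unramifiedSubgroup_iff_resSubgroup_absInertia_eq_zero W p w y).mpr
      (resSubgroup_absInertia_eq_zero_of_forall_tateLocalMap_mem_unramifiedSubgroup W p w y hy)


/-! ### §2 At `w ∤ p`: `𝓕_u(w)_k = π_{k+1,*} H¹_ur`, `𝓕_can(w)_k = π_{k+1,*} H¹`, and the `red`-tower -/

section Structures

variable (k : ℕ)

/-- **`𝓕_u(w)_k = π_{k+1,*} H¹_ur(ℚ_w, T_pE)`** ([MR04] Remark A.5's unramified condition on `E[p^k · p]` at
a finite `w ∤ p`, the tree's `blochKatoSelmerStructure p (tateTorsionDatum W p k) L (Sum.inr w)`, IS the image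
of the unramified subgroup of `H¹(ℚ_w, T_pE)` under `π_{k+1,*}` — gen 2's reading, by definition of the
Bloch–Kato finite subgroup). [cite: MazurRubin2004, App. A Remark A.5 (p. 81)] [cite: BlochKato1990, (3.7.1)] -/
theorem blochKatoSelmerStructure_inr_eq_map (L : (tateTorsionDatum W p k).LocalConditionsAbove p)
    (hw : ((p : ℕ) : 𝓞 ℚ) ∉ w.asIdeal) :
    blochKatoSelmerStructure p (tateTorsionDatum W p k) L (Sum.inr w) =
      (GaloisRep.unramifiedSubgroup (𝕋) 1).map (tateLocalMap W p k (Sum.inr w)) := by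
  rw [blochKatoSelmerStructure_inr_of_not_mem _ L hw]
  rfl

/-- **`𝓕_can(w)_k = π_{k+1,*} H¹(ℚ_w, T_pE)`**: Mazur–Rubin's propagated condition is the range of
`π_{k+1,*}` (the tree's `mem_propagatedSelmerStructure_iff`, as an equality of subgroups).
[cite: MazurRubin2004, Def. 3.2.1 and Thm. 5.2.12 (i)] [cite: Rubin2011, §3.1 (p. 29)] -/
theorem propagatedSelmerStructure_eq_range (v : Place ℚ) :
    propagatedSelmerStructure W p k v = (tateLocalMap W p k v).range := by
  ext x
  rw [mem_propagatedSelmerStructure_iff, AddMonoidHom.mem_range]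

/-- `π_{k+1,*} H¹_ur(ℚ_w, T_pE) ≤ π_{k+1,*} H¹(ℚ_w, T_pE) = 𝓕_can(w)_k`. [folklore] -/
theorem map_unramifiedSubgroup_le_propagatedSelmerStructure :
    (GaloisRep.unramifiedSubgroup (𝕋) 1).map (tateLocalMap W p k (Sum.inr w)) ≤
      propagatedSelmerStructure W p k (Sum.inr w) := by
  rw [propagatedSelmerStructure_eq_range]
  exact AddSubgroup.map_le_range _ _

/-- `π_{k+1,*} H¹_ur(ℚ_w, T_pE)` is finite at `w ∤ p` (inside the finite `𝓕_can(w)_k`, part VII cor. §1). [folklore] -/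
theorem finite_map_unramifiedSubgroup (hw : ((p : ℕ) : 𝓞 ℚ) ∉ w.asIdeal) :
    Finite ((GaloisRep.unramifiedSubgroup (𝕋) 1).map (tateLocalMap W p k (Sum.inr w))) := by
  have hfin := KimAtThreeD7uTamagawaIndex.finite_propagatedSelmerStructure_inr W p k w hw
  exact @Finite.of_injective _ _ hfin
    (AddSubgroup.inclusion (map_unramifiedSubgroup_le_propagatedSelmerStructure W p w k))
    (AddSubgroup.inclusion_injective _)

/-- `#π_{k+1,*} H¹_ur(ℚ_w, T_pE) ≠ 0` at `w ∤ p` (finite and non-empty). [folklore] -/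
theorem natCard_map_unramifiedSubgroup_ne_zero (hw : ((p : ℕ) : 𝓞 ℚ) ∉ w.asIdeal) :
    Nat.card ((GaloisRep.unramifiedSubgroup (𝕋) 1).map (tateLocalMap W p k (Sum.inr w))) ≠ 0 := by
  haveI := finite_map_unramifiedSubgroup W p w k hw
  haveI : Nonempty ((GaloisRep.unramifiedSubgroup (𝕋) 1).map (tateLocalMap W p k (Sum.inr w))) := ⟨0⟩
  exact Nat.card_pos.ne'

/-- `𝓕_u(w)_k` is finite at `w ∤ p`. [folklore] -/
theorem finite_blochKatoSelmerStructure_inr (L : (tateTorsionDatum W p k).LocalConditionsAbove p)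
    (hw : ((p : ℕ) : 𝓞 ℚ) ∉ w.asIdeal) :
    Finite (blochKatoSelmerStructure p (tateTorsionDatum W p k) L (Sum.inr w)) := by
  rw [blochKatoSelmerStructure_inr_eq_map W p w k L hw]
  exact finite_map_unramifiedSubgroup W p w k hw

/-- **`#𝓕_can(w)_k = #π_{k+1,*} H¹_ur(ℚ_w, T_pE) · p^{v_p(c_w)}`** at a level `k` with `p^{v_p(c_w)} ∣ p^{k+1}`
(part VII cor. §3 `natCard_propagatedSelmerStructure_inr_eq_mul_pow_padicValNat`, with `𝓕_u(w)_k` spelled as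
the image `π_{k+1,*} H¹_ur`). [cite: Rubin2000, Lemma 1.3.5] [cite: MazurRubin2004, Prop. 6.2.6 (p. 75) and App. A Remark A.5 (p. 81)] -/
theorem natCard_propagatedSelmerStructure_eq_natCard_map_mul (hw : ((p : ℕ) : 𝓞 ℚ) ∉ w.asIdeal)
    (hk : p ^ padicValNat p ((W.baseChange (w.adicCompletion ℚ)).localTamagawaNumber
      (w.adicCompletionIntegers ℚ)) ∣ p ^ (k + 1)) :
    Nat.card (propagatedSelmerStructure W p k (Sum.inr w)) =
      Nat.card ((GaloisRep.unramifiedSubgroup (𝕋) 1).map (tateLocalMap W p k (Sum.inr w))) *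
        p ^ padicValNat p ((W.baseChange (w.adicCompletion ℚ)).localTamagawaNumber
          (w.adicCompletionIntegers ℚ)) := by
  let L : (tateTorsionDatum W p k).LocalConditionsAbove p := fun _ _ => ⊤
  have h := KimAtThreeD7uTamagawaIndex.natCard_propagatedSelmerStructure_inr_eq_mul_pow_padicValNat
    W p k w L hw hk
  rw [blochKatoSelmerStructure_inr_eq_map W p w k L hw] at h
  exact h

variable {k} {k' : ℕ}

/-- **`red_* ∘ π_{k'+1,*} = π_{k+1,*}` on `H¹(ℚ_v, T_pE)`** for any equivariant `red : E[p^{k'} · p] → E[p^k · p]`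
acting as `x ↦ p^{k'−k} x` (n1011's `TransportPrime.localMap_red_tateLocalMap`, on classes). [folklore] -/
theorem localMap_red_tateLocalMap_apply (hkk : k ≤ k')
    (red : (W.torsionGaloisModule ((p : ℤ) ^ k' * (p : ℤ))).toContRepresentation →ⁱL
      (W.torsionGaloisModule ((p : ℤ) ^ k * (p : ℤ))).toContRepresentation)
    (hred : ∀ x : geomTorsion W ((p : ℤ) ^ k' * (p : ℤ)),
      ((red x : geomTorsion W ((p : ℤ) ^ k * (p : ℤ))) : geomPoints W) =
        ((p : ℤ) ^ (k' - k)) • (x : geomPoints W))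
    (v : Place ℚ) (y : (tateLocalRep W p v).cohomology 1) :
    DiscreteGaloisModule.localMap red v (tateLocalMap W p k' v y) = tateLocalMap W p k v y := by
  obtain ⟨η, rfl⟩ := oneCocycleClass_surjective _ y
  exact TransportPrime.localMap_red_tateLocalMap W p hkk red hred v η

/-- **`red_* 𝓕_can(v)_{k'} = 𝓕_can(v)_k`** at every place (surjectivity of the canonical tower), for any
equivariant `red : E[p^{k'} · p] → E[p^k · p]`, `x ↦ p^{k'−k} x`. [cite: MazurRubin2004, Thm. 5.2.12 (i) and Example 3.1.6]
[cite: Rubin2011, §3.1 (p. 29)] -/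
theorem map_localMap_red_propagatedSelmerStructure (hkk : k ≤ k')
    (red : (W.torsionGaloisModule ((p : ℤ) ^ k' * (p : ℤ))).toContRepresentation →ⁱL
      (W.torsionGaloisModule ((p : ℤ) ^ k * (p : ℤ))).toContRepresentation)
    (hred : ∀ x : geomTorsion W ((p : ℤ) ^ k' * (p : ℤ)),
      ((red x : geomTorsion W ((p : ℤ) ^ k * (p : ℤ))) : geomPoints W) =
        ((p : ℤ) ^ (k' - k)) • (x : geomPoints W))
    (v : Place ℚ) :
    (propagatedSelmerStructure W p k' v).map (DiscreteGaloisModule.localMap red v) =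
      propagatedSelmerStructure W p k v := by
  rw [propagatedSelmerStructure_eq_range, propagatedSelmerStructure_eq_range, AddMonoidHom.map_range]
  ext x
  simp only [AddMonoidHom.mem_range, AddMonoidHom.coe_comp, Function.comp_apply,
    localMap_red_tateLocalMap_apply W p hkk red hred]

/-- **`red_* π_{k'+1,*} H¹_ur(ℚ_w, T_pE) = π_{k+1,*} H¹_ur(ℚ_w, T_pE)`** (surjectivity of [MR04] Remark A.5's
unramified tower, image spelling; any finite place, also above `p`), for any equivariant
`red : E[p^{k'} · p] → E[p^k · p]`, `x ↦ p^{k'−k} x`. [cite: MazurRubin2004, App. A Remark A.5 (p. 81)] -/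
theorem map_localMap_red_map_unramifiedSubgroup (hkk : k ≤ k')
    (red : (W.torsionGaloisModule ((p : ℤ) ^ k' * (p : ℤ))).toContRepresentation →ⁱL
      (W.torsionGaloisModule ((p : ℤ) ^ k * (p : ℤ))).toContRepresentation)
    (hred : ∀ x : geomTorsion W ((p : ℤ) ^ k' * (p : ℤ)),
      ((red x : geomTorsion W ((p : ℤ) ^ k * (p : ℤ))) : geomPoints W) =
        ((p : ℤ) ^ (k' - k)) • (x : geomPoints W)) :
    ((GaloisRep.unramifiedSubgroup (𝕋) 1).map (tateLocalMap W p k' (Sum.inr w))).map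
        (DiscreteGaloisModule.localMap red (Sum.inr w)) =
      (GaloisRep.unramifiedSubgroup (𝕋) 1).map (tateLocalMap W p k (Sum.inr w)) := by
  rw [AddSubgroup.map_map]
  ext x
  simp only [AddSubgroup.mem_map, AddMonoidHom.coe_comp, Function.comp_apply,
    localMap_red_tateLocalMap_apply W p hkk red hred]

/-- **`red_* 𝓕_u(w)_{k'} = 𝓕_u(w)_k`** at a finite `w ∤ p` (surjectivity of [MR04] Remark A.5's unramified
tower; gen 5 part XI `localMap_red_mem_blochKatoSelmerStructure` was the inclusion `⊆`), for any equivariant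
`red : E[p^{k'} · p] → E[p^k · p]`, `x ↦ p^{k'−k} x`. [cite: MazurRubin2004, App. A Remark A.5 (p. 81)] -/
theorem map_localMap_red_blochKatoSelmerStructure (hkk : k ≤ k')
    (red : (W.torsionGaloisModule ((p : ℤ) ^ k' * (p : ℤ))).toContRepresentation →ⁱL
      (W.torsionGaloisModule ((p : ℤ) ^ k * (p : ℤ))).toContRepresentation)
    (hred : ∀ x : geomTorsion W ((p : ℤ) ^ k' * (p : ℤ)),
      ((red x : geomTorsion W ((p : ℤ) ^ k * (p : ℤ))) : geomPoints W) =
        ((p : ℤ) ^ (k' - k)) • (x : geomPoints W))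
    (hw : ((p : ℕ) : 𝓞 ℚ) ∉ w.asIdeal)
    (L' : (tateTorsionDatum W p k').LocalConditionsAbove p) (L : (tateTorsionDatum W p k).LocalConditionsAbove p) :
    (blochKatoSelmerStructure p (tateTorsionDatum W p k') L' (Sum.inr w)).map
        (DiscreteGaloisModule.localMap red (Sum.inr w)) =
      blochKatoSelmerStructure p (tateTorsionDatum W p k) L (Sum.inr w) := by
  rw [blochKatoSelmerStructure_inr_eq_map W p w k' L' hw, blochKatoSelmerStructure_inr_eq_map W p w k L hw]
  exact map_localMap_red_map_unramifiedSubgroup W p w hkk red hred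

end Structures

end Summit.BirchSwinnertonDyer.BirchSwinnertonDyer.Theorems.KimAtThreeD7uTamagawaTateUnramified

end
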